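import Summits.Parity.GeneralizedHardyLittlewood.Theorems.DicksonFibrationDimOneStubPrimeSieveAux4
import Summits.Parity.GeneralizedHardyLittlewood.Theorems.DicksonFibrationDimOneStubSingularTail
import Summits.Parity.GeneralizedHardyLittlewood.Theorems.LeeYangFibresAbsoluteUpgradeSinglesDecayScale
import Literature.NumberTheory.Sieve.SieveFrameworkFundamentalLemma
import HarnessLib

/-!
# Route `DicksonFibration`, crux `DimOne` (stmt-Parity-0819), line `birth` (sieve-model reshape):
# the stub `stub_primeSieve` — one prime among `t − 1` sifted forms

We prove the registered stub `stub_primeSieve : PrimeSieve` (`PrimeClassSums → PrimeSieveMain`) of the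
skeleton of the crux `DimOne` (vocabulary file `Theorems/DicksonFibrationDimOneDefs.lean`): given the
Bombieri–Vinogradov class sums of `Λ` along a form (`PrimeClassSums`, a HYPOTHESIS here), uniformly over
non-degenerate systems `Ψ` of `t` forms with `‖Ψ‖_N ≤ L`, indices `i` and integer intervals
`I = [m₁, m₂] ⊆ [−N, N]` on which every form is `≥ 1`,
`|(P/φ(P))^{t−1} Σ_{m ∈ I : (ψ_k(m), P) = 1 ∀ k ≠ i} Λ(ψ_i(m)) − #I · ∏_{p ≤ ⌊y⌋} β_p(Ψ)| ≤ ε N`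
for `N ≥ N₀(t, L, ε)` (`y = y_N = N^{1/u}`, `u = ⌈√(log N)⌉`, `P = P_N = ∏_{p ≤ ⌊y⌋} p`).

Proof (Halberstam–Richert Thm. 2.5 for a weighted sequence; helper files
`Theorems/DicksonFibrationDimOneStubPrimeSieveAux{1,2,3,4}.lean`):
* `t = 0` is vacuous; for `t + 1` forms write `ψ_i = a m + b`, `F = ∏_{k ≠ i} ψ_k`;
* a LOCAL OBSTRUCTION (`ω_{F_Ψ}(p) = p`, `p ≤ L + t + 1 ≤ ⌊y⌋`) kills the main term (`β_p = 0`) and leaves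
  only the powers of `p` in the sifted sum, `≤ 3 (log 2LN)² = o(N/(P/φ(P))^t)`;
* otherwise `(a, b) = 1` and the sifted sum is `S(𝒜, z)` for the weighted value sequence
  `a_v = Σ_{m ∈ I : F(m) = v} Λ(a m + b)` with size `X_i = |a| #I/φ(|a|)` and density `g`
  (`Ω(2(L + t))`); the Fundamental Lemma at level `D = N^{1/8} ≥ z = ⌊y⌋ + 1` gives
  `|S − X_i V(z)| ≤ C_FL X_i V(z) e^{−u/16} + Σ_{d ≤ D} |R_d|`, the remainders being class sums of `Λ`
  (`PrimeClassSums` at `x = 2LN`, `B = L + t`, `A = t + 1`, moduli `|a| d ≤ L N^{1/8} ≤ x^{1/4}`) plus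
  `≤ D² · 3 (log x)²` from the bad classes;
* the main terms agree EXACTLY: `(P/φ(P))^t X_i V(z) = #I ∏_{p ≤ ⌊y⌋} β_p`;
* numerics: `P/φ(P) ≤ e⁵ log N`, `∏ β_p ≤ (e⁵ log N)^{t+1}`, `#I ≤ 3N`, so the error is
  `≤ 3 C_FL N (e⁵ log N)^{t+1} e^{−u/16} + 2 L max(C,1) e^{5t} N/log N + 12 e^{5t} (log N)^{t+2} N^{1/4} ≤ ε N`.

References: H. Halberstam, H.-E. Richert, *Sieve Methods* (1974), Thm. 2.5 and §5.7
[HalberstamRichert1974]; J. Friedlander, H. Iwaniec, *Opera de Cribro* (2010), Cor. 6.10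
[FriedlanderIwaniecOpera2010]; B. Green, T. Tao, Ann. of Math. 171 (2010), (1.5)–(1.7) [GreenTao2010];
H. Iwaniec, E. Kowalski, *Analytic Number Theory* (2004), Thm. 17.1 [IwaniecKowalski2004].
-/

noncomputable section

open scoped BigOperators Classical
open Finset Filter Polynomial Literature.NumberTheory.Sieve
open Summit.Parity.GeneralizedHardyLittlewood.Theorems.AbsoluteUpgrade

namespace Summit.Parity.GeneralizedHardyLittlewood.Cruxes.DimOne.BirthSieve

/-- **One prime among sifted forms (`stub_primeSieve`).** The Bombieri–Vinogradov class sums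
(`PrimeClassSums`) imply, uniformly over non-degenerate `Ψ` of `t` forms with `‖Ψ‖_N ≤ L`, `i`, and
integer intervals `I = [m₁, m₂] ⊆ [−N, N]` on which every form is `≥ 1`:
`|(P_N/φ(P_N))^{t−1} Σ_{m ∈ I : (ψ_k(m), P_N) = 1 ∀ k ≠ i} Λ(ψ_i(m)) − #I · ∏_{p ≤ ⌊y_N⌋} β_p(Ψ)| ≤ ε N`
for `N ≥ N₀(t, L, ε)`: the Fundamental Lemma of dimension `t − 1` for the sequence
`a_v = Σ_{m ∈ I : F(m) = v} Λ(ψ_i(m))`, `F = ∏_{k ≠ i} ψ_k`, with size `|a_i| #I/φ(|a_i|)`, density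
`g` (`hasSieveDimension_density`) and level `N^{1/8}` (remainders from `PrimeClassSums`, bad classes
carry only prime powers); the main terms agree EXACTLY (`weight_pow_mul_size_mul_prod_eq`); a local
obstruction makes both sides `o(N)`. [cite: HalberstamRichert1974, Thm. 2.5 and §5.7] -/
theorem stub_primeSieve : PrimeSieve := by
  intro hCS t L ε hε
  rcases Nat.eq_zero_or_pos t with ht0 | htpos
  · subst ht0; exact ⟨0, fun N _ Ψ _ _ i => i.elim0⟩
  obtain ⟨t, rfl⟩ : ∃ t', t = t' + 1 := ⟨t - 1, by omega⟩
  simp only [Nat.add_sub_cancel]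
  -- constants depending on `t, L, ε` only
  obtain ⟨CFL, hCFL0, hFL⟩ := SieveSequence.fundamental_lemma_uniform_holds ((2 * (L + t) : ℕ) : ℝ)
    (Real.exp (((2 * (L + t) : ℕ) : ℝ) * (9 / 2 + 6 / Real.log 2) +
      ((2 * (L + t) : ℕ) : ℝ) ^ 2 / (1 / ((2 * (L + t) : ℕ) + 2 : ℝ))))
  obtain ⟨C, x₀, hC⟩ := hCS (L + t) (t + 1)
  set C' : ℝ := max C 1 with hC'
  have hC'0 : 0 ≤ C' := le_trans zero_le_one (le_max_right _ _)
  -- thresholds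
  have hc1 : (1 : ℝ) ≤ ((L + t + 3 : ℕ) : ℝ) := by exact_mod_cast (by omega : 1 ≤ L + t + 3)
  have hA1 : (0 : ℝ) ≤ 3 * CFL * Real.exp 5 ^ (t + 1) := by positivity
  have hA2 : (0 : ℝ) ≤ 12 * Real.exp 5 ^ t := by positivity
  have hL'0 : (0 : ℝ) < max (L : ℝ) 1 := lt_max_of_lt_right one_pos
  obtain ⟨N₀, hN₀⟩ := Filter.eventually_atTop.mp ((eventually_roughLevel _ hc1).and
    ((eventually_decay (t + 1) hA1 (show 0 < ε / 3 by positivity)).and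
      ((eventually_pow_log_mul_rpow (t + 2) hA2 (show 0 < ε / 3 by positivity)).and
        ((eventually_ge_real (max x₀ 0)).and
          ((eventually_log_ge (max 1 (6 * L * C' * Real.exp 5 ^ t / ε))).and
            ((eventually_ge_real (2 * L)).and (eventually_quarter hL'0)))))))
  refine ⟨N₀, fun N hN Ψ hΨ hL i m₁ m₂ hI => ?_⟩
  obtain ⟨⟨hN1, hu17, hyc, hzD⟩, hdec, hpol, hx₀N, hClog, hN2L, hquarter⟩ := hN₀ N hN
  -- notation
  set u : ℕ := roughExp N with hu
  set y : ℝ := roughLevel N with hy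
  set n : ℕ := ⌊y⌋₊ with hn
  set z : ℝ := ((n + 1 : ℕ) : ℝ) with hz
  set I := Icc m₁ m₂ with hIdef
  set a : ℤ := (Ψ i).coeff 0 with hadef
  set b : ℤ := (Ψ i).const with hbdef
  set D : ℝ := (N : ℝ) ^ ((1 : ℝ) / 8) with hD
  set E := Real.exp (-(Real.log D / Real.log z)) with hE
  set W := sieveWeight N with hW
  set x : ℝ := 2 * L * N with hxdef
  set Θ : ℝ := (Real.log x / Real.log 2 + 1) * Real.log x with hΘ
  have hP : sieveModulus N = primesProdBelow z := rfl
  have hWdef : W = (primesProdBelow z : ℝ) / (Nat.totient (primesProdBelow z) : ℝ) := rfl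
  -- basic facts
  have haL : ∀ k, ((Ψ k).coeff 0).natAbs ≤ L := fun k => natAbs_coeff_le_of_affLinSize_le hL k 0
  have hIpos : ∀ m ∈ I, ∀ k, 1 ≤ (Ψ k).eval (fun _ => m) := fun m hm => (hI m hm).2
  have hL1 : (1 : ℝ) ≤ L := one_le_of_affLinSize_le Ψ hΨ hL i
  have hN0 : (0 : ℝ) < N := by linarith
  have hNnat : 1 ≤ N := by exact_mod_cast hN1
  have hu1 : 1 ≤ u := le_trans (by norm_num) hu17
  have hc2 : (2 : ℝ) ≤ ((L + t + 3 : ℕ) : ℝ) := by exact_mod_cast (by omega : 2 ≤ L + t + 3)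
  have hy2 : (2 : ℝ) ≤ y := hc2.trans hyc
  have hy0 : (0 : ℝ) ≤ y := by linarith
  have hnc : L + t + 3 ≤ n := Nat.le_floor hyc
  have hn2 : 2 ≤ n := le_trans (by omega) hnc
  have hz2 : (2 : ℝ) ≤ z := by rw [hz]; exact_mod_cast (by omega : 2 ≤ n + 1)
  have hz1 : (1 : ℝ) < z := by linarith
  have hzle : z ≤ 2 * y := by
    rw [hz]; push_cast; linarith [Nat.floor_le hy0]
  have hu0 : (0 : ℝ) < u := by exact_mod_cast hu1
  have hyN : y ≤ N := by
    have h : (N : ℝ) ^ ((1 : ℝ) / u) ≤ (N : ℝ) ^ (1 : ℝ) :=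
      Real.rpow_le_rpow_of_exponent_le hN1 ((div_le_one hu0).mpr (by exact_mod_cast hu1))
    rw [Real.rpow_one] at h
    exact h
  have ha0 : a ≠ 0 := coeff_ne_zero_of_nondegenerate hΨ i
  have hev : ∀ m : ℤ, (Ψ i).eval (fun _ => m) = a * m + b := fun m => by rw [DimOne.eval_eq]
  have hab1 : ∀ m ∈ I, 1 ≤ a * m + b := fun m hm => by rw [← hev]; exact hIpos m hm i
  have hxle : ∀ m ∈ I, ((a * m + b : ℤ) : ℝ) ≤ x := fun m hm => by
    have h := abs_eval_le_of_affLinSize_le (L := (L : ℝ)) hNnat hL (const_mem_latticeBox (hI m hm).1) i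
    rw [hev] at h
    exact le_trans (le_abs_self _) h
  -- logarithms
  have hlogN1 : 1 ≤ Real.log N := le_trans (le_max_left _ _) hClog
  have h2L1 : (1 : ℝ) ≤ 2 * L := by linarith
  have hxN : (N : ℝ) ≤ x := by
    rw [hxdef]
    calc (N : ℝ) = 1 * N := (one_mul _).symm
      _ ≤ 2 * L * N := mul_le_mul_of_nonneg_right h2L1 hN0.le
  have hx1 : (1 : ℝ) ≤ x := hN1.trans hxN
  have hlogx : Real.log N ≤ Real.log x := Real.log_le_log hN0 hxN
  have hlogx1 : 1 ≤ Real.log x := hlogN1.trans hlogx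
  have hlogx2 : Real.log x ≤ 2 * Real.log N := by
    have hxN2 : x ≤ (N : ℝ) ^ 2 := by
      rw [hxdef, sq]
      exact mul_le_mul_of_nonneg_right hN2L hN0.le
    calc Real.log x ≤ Real.log ((N : ℝ) ^ 2) := Real.log_le_log (by linarith) hxN2
      _ = 2 * Real.log N := by rw [Real.log_pow]; push_cast; ring
  have hΘ0 : 0 ≤ Θ := by
    have hlog2 : 0 < Real.log 2 := Real.log_pos one_lt_two
    have : 0 ≤ Real.log x := by linarith
    positivity
  have hΘle : Θ ≤ 12 * Real.log N ^ 2 := theta_le hlogx1 hlogx2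
  -- the sieve weight
  have hW0 : 0 ≤ W := by rw [hWdef]; positivity
  have hWle : W ≤ Real.exp 5 * Real.log N := by
    have h1 : W ≤ Real.exp 5 * Real.log n := by rw [hWdef]; exact weight_le hn2
    have hn0 : (0 : ℝ) < n := by exact_mod_cast (show 0 < n by omega)
    have h2 : Real.log n ≤ Real.log N := Real.log_le_log hn0 ((Nat.floor_le hy0).trans hyN)
    have h3 := mul_le_mul_of_nonneg_left h2 (Real.exp_pos 5).le
    linarith
  have hWt : W ^ t ≤ Real.exp 5 ^ t * Real.log N ^ t := by
    rw [← mul_pow]; exact pow_le_pow_left₀ hW0 hWle t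
  have hXle : (#I : ℝ) ≤ 3 * N := by
    have h1 : #I ≤ #(Icc (-(N : ℤ)) N) := Finset.card_le_card fun m hm => (hI m hm).1
    have h2 : #(Icc (-(N : ℤ)) N) = 2 * N + 1 := by
      rw [Int.card_Icc]; omega
    rw [h2] at h1
    have h3 : (#I : ℝ) ≤ ((2 * N + 1 : ℕ) : ℝ) := by exact_mod_cast h1
    push_cast at h3
    linarith
  -- the common small error `W^t D² Θ ≤ (ε/3) N`
  have hD1 : 1 ≤ D := Real.one_le_rpow hN1 (by norm_num)
  have hsmall : W ^ t * (D ^ 2 * Θ) ≤ ε / 3 * N := by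
    have hD2 : D ^ 2 = (N : ℝ) ^ ((1 : ℝ) / 4) := by
      rw [hD, sq, ← Real.rpow_add' (Nat.cast_nonneg N) (by norm_num)]; norm_num
    rw [hD2]
    calc W ^ t * ((N : ℝ) ^ ((1 : ℝ) / 4) * Θ)
        ≤ (Real.exp 5 ^ t * Real.log N ^ t) * ((N : ℝ) ^ ((1 : ℝ) / 4) * (12 * Real.log N ^ 2)) := by
          gcongr
      _ = 12 * Real.exp 5 ^ t * Real.log N ^ (t + 2) * (N : ℝ) ^ ((1 : ℝ) / 4) := by ring
      _ ≤ ε / 3 * N := hpol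
  have hsmall' : W ^ t * Θ ≤ ε / 3 * N := by
    refine le_trans (mul_le_mul_of_nonneg_left ?_ (pow_nonneg hW0 t)) hsmall
    have hD2 : 1 ≤ D ^ 2 := one_le_pow₀ hD1
    calc Θ = 1 * Θ := (one_mul _).symm
      _ ≤ D ^ 2 * Θ := mul_le_mul_of_nonneg_right hD2 hΘ0
  have hε3 : ε / 3 * N ≤ ε * N := by
    have : ε / 3 ≤ ε := by linarith
    exact mul_le_mul_of_nonneg_right this hN0.le
  -- rewrite the summand `Λ(ψ_i(m)) = Λ(a m + b)`
  simp_rw [hev]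
  ------------------------------------------------------------------
  -- CASE A: a local obstruction
  ------------------------------------------------------------------
  by_cases hobs : ∀ p : ℕ, p.Prime → polyRootCountMod ![sysPoly Ψ] p < p
  swap
  · push Not at hobs
    obtain ⟨p, hp, hple⟩ := hobs
    have hρ : polyRootCountMod ![sysPoly Ψ] p = p := le_antisymm (polyRootCountMod_le _ p) hple
    have hpn : p ≤ n := by
      have h := rootCount_le_add hΨ haL hp
      rw [hρ] at h
      omega
    have hpP : p ∣ sieveModulus N := by
      rw [hP]
      exact (dvd_primesProdBelow_iff hp z).mpr (by rw [hz]; exact_mod_cast Nat.lt_succ_of_le hpn)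
    have hSle := sifted_sum_le_of_obstructed hΨ i hp hρ hpP I hx1 hab1 hxle
    have hS0 : 0 ≤ ∑ m ∈ I.filter
        (fun m : ℤ => ∀ k, k ≠ i → Int.gcd ((Ψ k).eval (fun _ => m)) (sieveModulus N) = 1),
          intVonMangoldt (a * m + b) :=
      Finset.sum_nonneg fun m _ => ArithmeticFunction.vonMangoldt_nonneg
    rw [singularProductPartial_eq_zero_of_obstructed Ψ hp hρ hpn, mul_zero, sub_zero,
      abs_of_nonneg (mul_nonneg (pow_nonneg hW0 t) hS0)]
    exact ((mul_le_mul_of_nonneg_left hSle (pow_nonneg hW0 t)).trans hsmall').trans hε3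
  ------------------------------------------------------------------
  -- CASE B: no local obstruction — the sieve
  ------------------------------------------------------------------
  rcases lt_or_ge m₂ m₁ with hm | hm
  · -- the empty interval
    have hI0 : I = ∅ := Finset.Icc_eq_empty_of_lt hm
    rw [hI0]
    simp only [Finset.filter_empty, Finset.sum_empty, mul_zero, Finset.card_empty, Nat.cast_zero,
      zero_mul, sub_zero, abs_zero]
    positivity
  have hab : IsCoprime a b := isCoprime_of_unobstructed Ψ i hobs
  -- the generic case, from helper file 4
  have hx₀ : x₀ ≤ x := le_trans (le_max_left _ _) (hx₀N.trans hxN)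
  have hD0 : 0 ≤ D := by linarith
  have hDnle : (((a.natAbs * ⌊D⌋₊ : ℕ)) : ℝ) ≤ x ^ (1 / 4 : ℝ) := by
    rw [max_eq_left hL1] at hquarter
    push_cast
    calc (a.natAbs : ℝ) * (⌊D⌋₊ : ℝ) ≤ (L : ℝ) * D :=
          mul_le_mul (by exact_mod_cast haL i) (Nat.floor_le hD0) (Nat.cast_nonneg _) (Nat.cast_nonneg _)
      _ ≤ (2 * L * N) ^ ((1 : ℝ) / 4) := hquarter
  -- the density of the weighted sequence
  let g : ArithmeticFunction ℝ :=
    ⟨fun d => if d = 0 then 0 else ∏ p ∈ d.primeFactors,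
      (#((rootsMod (sysPoly (Fin.removeNth i Ψ)) p).filter
          (fun s : ℕ => Int.gcd (a * s + b) p = 1)) : ℝ) /
        (if (p : ℤ) ∣ a then (p : ℝ) else (p : ℝ) - 1), if_pos rfl⟩
  have hg : ∀ d : ℕ, d ≠ 0 → g d = ∏ p ∈ d.primeFactors,
      (#((rootsMod (sysPoly (Fin.removeNth i Ψ)) p).filter
          (fun s : ℕ => Int.gcd (a * s + b) p = 1)) : ℝ) /
        (if (p : ℤ) ∣ a then (p : ℝ) else (p : ℝ) - 1) := fun d hd => if_neg hd
  have hcore := abs_sifted_sum_sub_le hFL hC hΨ haL i hobs hm hIpos hx1 hx₀ hxle hz2 hzD hDnle hg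
  -- names for the pieces
  set S : ℝ := ∑ m ∈ I.filter
      (fun m : ℤ => ∀ k, k ≠ i → Int.gcd ((Ψ k).eval (fun _ => m)) (sieveModulus N) = 1),
        intVonMangoldt (a * m + b) with hSdef
  set Xi : ℝ := ((a.natAbs : ℕ) : ℝ) / (Nat.totient a.natAbs : ℝ) * #I with hXi
  set V := ∏ p ∈ Nat.primesBelow ⌈z⌉₊, (1 - g p) with hVdef
  change |S - Xi * V| ≤ CFL * Xi * V * E + (C' * x / Real.log x ^ (t + 1) + D ^ 2 * Θ) at hcore
  -- the main term: `W^t Xi V = #I ∏_{p ≤ n} β_p`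
  have han : a.natAbs ≤ n := (haL i).trans (by omega)
  have hmain : W ^ t * Xi * V = #I * singularProductPartial Ψ n := by
    have h := weight_pow_mul_size_mul_prod_eq Ψ i hg hab ha0 han
    rw [hWdef, hXi, hVdef, ← h, hz]
    ring
  -- numerics of the error terms
  have hSP0 : 0 ≤ singularProductPartial Ψ n := Finset.prod_nonneg fun p _ => localFactor_nonneg Ψ p
  have hSPle : singularProductPartial Ψ n ≤ Real.exp 5 ^ (t + 1) * Real.log N ^ (t + 1) := by
    refine (singularProductPartial_le_log_pow Ψ hn2).trans ?_
    rw [mul_pow]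
    have hn0 : (0 : ℝ) < n := by exact_mod_cast (show 0 < n by omega)
    have h2 : Real.log n ≤ Real.log N := Real.log_le_log hn0 ((Nat.floor_le hy0).trans hyN)
    have hlogn0 : 0 ≤ Real.log n := Real.log_nonneg (by exact_mod_cast (show 1 ≤ n by omega))
    gcongr
  have hE0 : 0 ≤ E := (Real.exp_pos _).le
  have hy2' : (2 : ℝ) ≤ (N : ℝ) ^ ((1 : ℝ) / u) := hy2
  have hzle' : z ≤ 2 * (N : ℝ) ^ ((1 : ℝ) / u) := hzle
  have hEle : E ≤ Real.exp (-((1 : ℝ) / 16 * u)) := exp_neg_le_exp_neg_div hu1 hy2' hz1 hzle'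
  have hT1 : CFL * #I * singularProductPartial Ψ n * E ≤ ε / 3 * N := by
    calc CFL * #I * singularProductPartial Ψ n * E
        ≤ CFL * (3 * N) * (Real.exp 5 ^ (t + 1) * Real.log N ^ (t + 1)) *
            Real.exp (-((1 : ℝ) / 16 * u)) := by gcongr
      _ = N * (3 * CFL * Real.exp 5 ^ (t + 1) * Real.log N ^ (t + 1) *
            Real.exp (-((1 : ℝ) / 16 * u))) := by ring
      _ ≤ N * (ε / 3) := mul_le_mul_of_nonneg_left hdec hN0.le
      _ = ε / 3 * N := by ring
  have hClog' : 6 * L * C' * Real.exp 5 ^ t / ε ≤ Real.log N := le_trans (le_max_right _ _) hClog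
  have hT2 : W ^ t * (C' * x / Real.log x ^ (t + 1)) ≤ ε / 3 * N :=
    weight_pow_mul_bv_le hWt hC'0 (by linarith) hN0 hε hxdef (by linarith) hlogx hClog'
  have hT3 : W ^ t * (D ^ 2 * Θ) ≤ ε / 3 * N := hsmall
  -- assembly
  have key : W ^ t * S - #I * singularProductPartial Ψ n = W ^ t * (S - Xi * V) := by
    rw [← hmain]; ring
  rw [key, abs_mul, abs_of_nonneg (pow_nonneg hW0 t)]
  calc W ^ t * |S - Xi * V|
      ≤ W ^ t * (CFL * Xi * V * E + (C' * x / Real.log x ^ (t + 1) + D ^ 2 * Θ)) :=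
        mul_le_mul_of_nonneg_left hcore (pow_nonneg hW0 t)
    _ = CFL * (W ^ t * Xi * V) * E + W ^ t * (C' * x / Real.log x ^ (t + 1)) + W ^ t * (D ^ 2 * Θ) := by
        ring
    _ = CFL * #I * singularProductPartial Ψ n * E + W ^ t * (C' * x / Real.log x ^ (t + 1)) +
          W ^ t * (D ^ 2 * Θ) := by rw [hmain]; ring
    _ ≤ ε / 3 * N + ε / 3 * N + ε / 3 * N := add_le_add (add_le_add hT1 hT2) hT3
    _ = ε * N := by ring

end Summit.Parity.GeneralizedHardyLittlewood.Cruxes.DimOne.BirthSieve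

end
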